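import Mathlib
import Summits.Ventures.PercRepro2.TypedBasesStar

/-!
# Class sums as sums over the admissible edge colourings (blind cell PercRepro2, typer-1 g45,
2026-08-27)

`typedClassCount F z τ S x₀ y₀ w₀ K` (`TypedBasesStar.lean`) sums `K x y w` over ALL triples of
configurations, filtering the typed class by an `if`; the kernel cannot enumerate
`(Config E)³` for `|E| = 9` (`2^27` triples).  Here the same class sum is rewritten as a sum over
the product finset `Fintype.piFinset (edgeClass …)` of the colourings admissible edge by edge
(`3^|F|` elements when every `τ e ∈ {1, 2}` — `2,187` for the (TRI-o) witness):

* `edgeClass F z τ S x₀ y₀ w₀ e` — the colourings `(x e, y e, w e)` allowed at the edge `e`;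
* `typedClassCount_eq_sum_piFinset` — the class sum is the sum of `K` over `piFinset edgeClass`.

Written for the kernel refutation of (TRI-o) (`TypedBasesStarRefutation.lean`).  Own work;
standard axioms.
-/

namespace Summit.Ventures.PercRepro2

namespace CovForm

section Pi

variable {E : Type*} [Fintype E] [DecidableEq E] {R : Type*} [Field R]

/-- The colourings `(x e, y e, w e)` admissible at the edge `e` in the class
`(F, z, τ, S, x₀, y₀, w₀)`: `z e` on all three copies off `F`, open count `τ e` on `F`, the
prescribed colouring on `S`. -/
def edgeClass (F : Finset E) (z : Config E) (τ : E → ℕ) (S : Finset E) (x₀ y₀ w₀ : Config E)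
    (e : E) : Finset (Bool × Bool × Bool) :=
  Finset.univ.filter fun p =>
    (e ∉ F → p.1 = z e ∧ p.2.1 = z e ∧ p.2.2 = z e) ∧
    (e ∈ F → p.1.toNat + p.2.1.toNat + p.2.2.toNat = τ e) ∧
    (e ∈ S → p.1 = x₀ e ∧ p.2.1 = y₀ e ∧ p.2.2 = w₀ e)

/-- A function to triples as a triple of functions. -/
def tripleEquiv (E : Type*) : (E → Bool × Bool × Bool) ≃ Config E × Config E × Config E :=
  (Equiv.arrowProdEquivProdArrow E (fun _ => Bool) (fun _ => Bool × Bool)).trans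
    (Equiv.prodCongr (Equiv.refl _) (Equiv.arrowProdEquivProdArrow E (fun _ => Bool) (fun _ => Bool)))

/-- A triple sum over configurations is a sum over functions to triples. -/
lemma sum3_eq_sum_fun (φ : Config E → Config E → Config E → R) :
    (∑ x : Config E, ∑ y : Config E, ∑ w : Config E, φ x y w) =
      ∑ g : E → Bool × Bool × Bool, φ (fun e => (g e).1) (fun e => (g e).2.1) (fun e => (g e).2.2) := by
  symm
  refine (Fintype.sum_equiv (tripleEquiv E)
    (fun g => φ (fun e => (g e).1) (fun e => (g e).2.1) (fun e => (g e).2.2))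
    (fun q : Config E × Config E × Config E => φ q.1 q.2.1 q.2.2) (fun g => rfl)).trans ?_
  rw [Fintype.sum_prod_type]
  simp only [Fintype.sum_prod_type]

/-- The triples of the class, as functions to triples. -/
lemma filter_class_eq_piFinset (F : Finset E) (z : Config E) (τ : E → ℕ) (S : Finset E)
    (x₀ y₀ w₀ : Config E) :
    (Finset.univ.filter fun g : E → Bool × Bool × Bool =>
        ((∀ e, e ∉ F → (g e).1 = z e ∧ (g e).2.1 = z e ∧ (g e).2.2 = z e) ∧
          (∀ e ∈ F, openCount (fun e => (g e).1) (fun e => (g e).2.1) (fun e => (g e).2.2) e = τ e)) ∧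
        (∀ e ∈ S, (g e).1 = x₀ e ∧ (g e).2.1 = y₀ e ∧ (g e).2.2 = w₀ e)) =
      Fintype.piFinset (edgeClass F z τ S x₀ y₀ w₀) := by
  ext g
  simp only [Finset.mem_filter, Finset.mem_univ, true_and, Fintype.mem_piFinset, edgeClass,
    openCount]
  constructor
  · rintro ⟨⟨h1, h2⟩, h3⟩ e
    exact ⟨h1 e, h2 e, h3 e⟩
  · intro h
    exact ⟨⟨fun e => (h e).1, fun e => (h e).2.1⟩, fun e => (h e).2.2⟩

/-- **The class sum as a sum over the admissible colourings**: `typedClassCount` is the sum of `K`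
over `Fintype.piFinset (edgeClass …)`. -/
theorem typedClassCount_eq_sum_piFinset (F : Finset E) (z : Config E) (τ : E → ℕ) (S : Finset E)
    (x₀ y₀ w₀ : Config E) (K : Config E → Config E → Config E → R) :
    typedClassCount F z τ S x₀ y₀ w₀ K =
      ∑ g ∈ Fintype.piFinset (edgeClass F z τ S x₀ y₀ w₀),
        K (fun e => (g e).1) (fun e => (g e).2.1) (fun e => (g e).2.2) := by
  unfold typedClassCount
  rw [sum3_eq_sum_fun, ← filter_class_eq_piFinset, Finset.sum_filter]

end Pi

end CovForm

end Summit.Ventures.PercRepro2
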